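import Summits.BirchSwinnertonDyer.Rank1Residual.X11b.VisibilityRankOne
import Summits.BirchSwinnertonDyer.Rank1Residual.GaloisImage.FrobeniusOrderWitness
import Summits.BirchSwinnertonDyer.Rank1Residual.X11b.CertificateCheckBridge
import Summits.BirchSwinnertonDyer.Rank1Residual.GaloisImage.ThreeCongruenceHesseCertificateLemmas
import Literature.NumberTheory.EllipticCurves.Fisher2012.HesseFamilyThreeReverseProofs
import Summits.BirchSwinnertonDyer.Rank1Residual.Visibility.RankOneTwoWitnessPairs1
import Summits.BirchSwinnertonDyer.Rank1Residual.Visibility.TwoWitnessLowerHalf443400c1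
import Summits.BirchSwinnertonDyer.Rank1Residual.Visibility.TwoWitnessLowerHalf352944s1
import HarnessLib

/-!
# BSD rank-≤1 residual cell: rank-one TWO-WITNESS visibility compositions at `p = 3` (VIS-2W), file 2 — `307520bh1` (X7, θ-free twin), `443400c1` (X11b), `352944s1` (X4)

HONEST FRAMING (cell `b2b-bsdres-*`, run/shared/lean/b2b/bsd-rank1-residual/, verbatim): the goal of the cell is to DELETE the
COMBINATION-SHAPED residual classes for ALL analytic-rank `≤ 1` elliptic curves over `ℚ` — "full BSD formula for every rank `≤ 1`
curve in class C" assembled STRICTLY from published theorems — so that the rank-`≤ 1` remainder becomes exactly the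
CONSTRUCTION-SHAPED classes, which are TYPED (missing-input Props), NOT attempted; this is not "finishing BSD". Prove what is
provable now; shrink each hard class to its core with data; no claim beyond stated classes. Unit `b2b-bsdres-x11c` GEN 34
(lit GEN 146 wake item (ii) «VIS-2W»). THEOREMS ONLY (no definition, no named fact introduced); PER PAIR (a certificate shape),
NOT a class theorem; classes X11b / X7 stay as labelled; nothing is booked by this file; the desk prices.

## What this file does

The x11c gen-4/6 rank-one visibility lever (`X11b.bsdp_of_kolyvagin_of_congr`, VIS30 `Visibility/RankOnePairs*`) needs ONE rank-`≥ 3`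
partner `E'` with `E'(ℚ_v)[3] = 0` at EVERY place of `S` — the binder that FAILS (`vis:loc-fails`, hyp ENGINE V `vis_rows.tsv`) on the
OPEN keys below. Team `bsd-addord` seat k1-c3 (gen 7) replaced that local condition by TWO explicit witnesses `T₁, T₂ ∈ E'(ℚ)`,
independent mod `3E'(ℚ)` and `3`-divisible (or harmless) at every place of `S` (doors p479804 / p488071, cell-free; kernel records
`missingLowerBoundAt_c<E>_3_of_congr`, re-homed here as `Visibility/TwoWitnessLowerHalf<E>.lean`) = the LOWER half
`ord₃ #Ш_an ≤ ord₃ #Ш`. This file COMPOSES, per key, that lower half BY NAME with Kolyvagin's UPPER half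
`ord₃ #Ш(E/ℚ) ≤ 2·ord₃ [E(K):ℤ y_K] ≤ 2` (`X11b.padicValNat_shaOrder_le_of_kolyvagin`: named facts `kolyvagin` (hKo) and
`Kolyvagin1990_padicValNat_card_sha_le` (hB) = McCallum 1991 §1 / Gross 1991 Thm 1.3, both PUBLISHED; the lane's Heegner datum
with `ord₃ [E(K):ℤP] ≤ 1` DISPLAYED as binders hK hH hP hnt hI) and `ρ̄_{E,3}` ONTO decided IN THE KERNEL (two Frobenius point counts,
`GaloisImage/FrobeniusOrderWitness`, or the landed `SecondDescent.surj3_s<E>` by name), into `bsdp_w<E> : … → θ → BSDp W 3` in the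
exact binder grammar of VIS30's `bsdp_v<label>` (hCT hGZK [hMR] W hW hKo hB hK hH hP hnt hI hr hs hv W' hW' θ hθ). The `3`-congruence
`θ : E'[3] ≃ E[3]` stays a DISPLAYED HYPOTHESIS TERM, certified outside the kernel by the Kraus–Oesterlé / Sturm bound with TWO engines
to the FULL bound (numbers per theorem). Nothing else is assumed: `E(ℚ)[3] = 0`, minimality, irreducibility, the local options of
the witnesses, independence and good reduction off `S` are kernel facts of the lower-half file.

References: [McCallumLMS1991] §1; [GrossLMS1991] Thm. 1.3; [CremonaMazur2000] §3; [AgasheStein2002] Lemma 3.6 / Thm. 3.1;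
[KrausOesterle1992] Prop. 4; [Serre1972] §2.4 Prop. 15; [MazurRubin2004] (Kolyvagin systems) resp. the tree's `selmerLocalKer_iff_of_goodReduction_above`
binder hMR where the key is good at `3`; [SilvermanAEC2009] X.4.14; [Miller2011LMS] Def. 1.1; [Cremona2006].
-/

set_option autoImplicit false

noncomputable section

open scoped Classical

open WeierstrassCurve Literature.NumberTheory.EllipticCurves
  Literature.NumberTheory.EllipticCurves.Rank1Residual
  Literature.NumberTheory.EllipticCurves.Rank1Residual.Typed
  Literature.NumberTheory.EllipticCurves.Rank1Residual.X11RankOneCertificates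
  Literature.NumberTheory.EllipticCurves.MazurRubin2015
  Literature.NumberTheory.EllipticCurves.Fisher2012
  Literature.NumberTheory.GaloisRepresentations
  Summit.BirchSwinnertonDyer.BirchSwinnertonDyer.Rank1Residual.IntModel
  Summit.BirchSwinnertonDyer.BirchSwinnertonDyer.Rank1Residual.X11RankOne
  Summit.BirchSwinnertonDyer.Rank1Residual.GaloisImage
  Summit.BirchSwinnertonDyer.Rank1Residual.X11b
open NumberField IsDedekindDomain

namespace Summit.BirchSwinnertonDyer.Rank1Residual.Visibility

/-! ### `307520bh1 @ 3` (class X7) — partner `307520bs1` (rank 2) — θ-free twin of the landed `bsdp_w307520bh1` -/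

/-- **`bsdp_w307520bh1` with θ/hθ DISCHARGED IN THE KERNEL** (HESSE GRADE, the n1011 ROW T-VIS3-TH twin pattern of VIS30's
`bsdpHesse_v<label>`): the partner `307520bs1` is `ℚ`-isomorphic to the member `(l : m) = (-37696 : 3)` (`u = 38440`) of the DIRECT (`X_E(3)`)
Hesse pencil of `E` (Fisher 2012 Thm. 13.2, `n = 3`; unconditional: `threeCongruent_of_hesseCertificate_unconditional`; certificate found by n1011's
`tvis3_hesse3_search.py` (f7173afc…) run by this unit, complete rational-root search of the degree-12 `j`-equation), so
`θ : W'[3] ≃ E[3]` comes from ONE call of `VisCerts.torsionIso3_of_hesseCert_mk` with ten `norm_num` identities. Remaining binders: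
hCT hGZK hMR W hW hKo hB hK hH hP hnt hI hr hs hv ⊢ `BSDp W 3` — NO θ, NO partner datum, NO local-torsion binder. Per pair; nothing booked.
[cite: Fisher2012Hessian, Thm. 13.2 (n = 3)] [cite: CremonaAlgorithms1997, §3.5] -/
theorem bsdpHesse_w307520bh1 (hCT : exists_casselsTate_pairing (K := ℚ))
    (hGZK : rank_eq_analyticRank_of_analyticRank_le_one)
    (hMR : selmerLocalKer_iff_of_goodReduction_above)
    (W : WeierstrassCurve ℚ) (hW : W = ⟨0, 0, 0, -1391528, -395386152⟩)
    {N : ℕ} [NeZero N] {K : Type} [Field K] [NumberField K] (hKo : kolyvagin N W K)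
    (hB : Kolyvagin1990_padicValNat_card_sha_le N W K) (hK : IsImaginaryQuadratic K)
    (hH : SatisfiesHeegnerHypothesis N K) {P : (W.baseChange K).toAffine.Point}
    (hP : IsHeegnerPoint N W K P) (hnt : ¬ IsOfFinAddOrder P)
    (hI : padicValNat 3 (AddSubgroup.zmultiples P).index ≤ 1)
    (hr : W.analyticRank = 1) {s : ℚ} (hs : shaAn W = (s : ℂ)) (hv : padicValRat 3 s = 2) :
    BSDp W 3 := by
  haveI : (⟨0, 0, 0, -1241612, 590576784⟩ : WeierstrassCurve ℚ).IsElliptic := isElliptic_c307520bs1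
  have hWlit : W = ⟨0, 0, 0, -1391528, -395386152⟩ := hW
  haveI : W.IsElliptic := by rw [hWlit]; exact isElliptic_c307520bh1
  obtain ⟨θ, hθ⟩ := VisCerts.torsionIso3_of_hesseCert_mk
    (W' := (⟨0, 0, 0, -1241612, 590576784⟩ : WeierstrassCurve ℚ)) hWlit rfl
    66793344 341613635328 59597376 (-510258341376) (by norm_num) (by norm_num) (by norm_num) (by norm_num)
    (-37696) 3 38440 (by norm_num) (by norm_num) (by norm_num)
  exact bsdp_w307520bh1 hCT hGZK hMR W hW hKo hB hK hH hP hnt hI hr hs hv _ rfl θ hθ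

/-! ### `443400c1 @ 3` (class X11b) — partner `443400b1` (rank 3) -/

/-- **`BSD(E,3)` for `443400c1`** (class X11b; `N = 443400 = 2³·3·5²·739`; at `3`: non-split multiplicative `I₁₁` (`c₃ = 1`), additive `II*` at `2`, `I₀*` at `5`, `I₁` at `739`; `ρ̄_{E,3}` onto; `r_an = 1`; `#E(ℚ)_tors = 1`;
`∏ c_q = 1`; `#Ш_an = 9`; other members of the isogeny class by `bsdp_iff_of_isIsogenous`) from PUBLISHED theorems — Kolyvagin's index
bound (`hKo`, `hB`: McCallum 1991 §1 / Gross 1991 Thm. 1.3), Cassels–Tate (`hCT`), Gross–Zagier–Kolyvagin (`hGZK`) — plus the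
per-pair certificates: UPPER half = a Heegner datum with `ord₃ [E(K):ℤP] ≤ 1` — the lane's two fields `D = -71` (`m = 18`) and `D = -119` (`m = 36`) read `ord₃ m = 2`
(`= 1 + ord₃ #Ш(E^D)/2`: `3 ∤ ∏c_q = 1`), so this unit scanned DEEPER fields (engine 1 = gen 3 engine VERBATIM, kit j276927, 24 Heegner
discriminants `|D| ≤ 2591`): `K = ℚ(√-239)`, `m = 6`, `ord₃ m = 1` (also `D = -311, -671, -791, -1319, …` with `ord₃ m = 1`; engine 2 = kit j277072), DISPLAYED as hK hH hP hnt hI; LOWER half =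
k1-c3 g7's two-witness KERNEL record `missingLowerBoundAt_c443400c1_3_of_congr` (`Visibility/TwoWitnessLowerHalf443400c1.lean`: partner
`W' = 443400b1` of rank `3`, witnesses `T₁, T₂ ∈ W'(ℚ)` independent mod `3W'(ℚ)` and locally `3`-divisible / harmless on `S = {2, 3, 5, 739}`,
`E[3]` irreducible, minimality, good reduction off `S` — all in the kernel) BY NAME, with the `3`-CONGRUENCE `θ : W'[3] ≃ E[3]` DISPLAYED
(certified outside the kernel: Kraus–Oesterlé `a_ℓ(E) ≡ a_ℓ(W') (mod 3)` for every `ℓ ≤ B = 177599` (`M = 443400`), TWO engines to the FULL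
bound, hyp ENGINE V-A (python) / V-B (PARI 2.17.2), jobs j082351–j083043, `vis_triples.tsv.gz` row (443400c1, 3, 443400b1): `H_cong = 1` agree, `cong_full_two_engine = True`); `ρ̄_{E,3}` onto by `SecondDescent.surj3_s443400c1` (landed, by name). Composition = `X11b.padicValNat_shaOrder_le_of_kolyvagin` +
`X11b.missingUpperBoundAt_of_padicValNat_shaOrder_le` + `bsdp_of_missingPPartAt`. Per pair; the lane / referee A book the verdict;
no label change; nothing booked here. [cite: McCallumLMS1991, §1 Theorem (Kolyvagin), p. 296] [cite: GrossLMS1991, Thm. 1.3]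
[cite: CremonaMazur2000, §3 and Table 1] [cite: AgasheStein2002, Lemma 3.6] [cite: KrausOesterle1992, Prop. 4]
[cite: Miller2011LMS, §1 and Def. 1.1] [cite: Cremona2006, Table 1 (443400c1, 443400b1)] -/
theorem bsdp_w443400c1 (hCT : exists_casselsTate_pairing (K := ℚ))
    (hGZK : rank_eq_analyticRank_of_analyticRank_le_one)
    (W : WeierstrassCurve ℚ) (hW : W = ⟨0, -1, 0, -1172008, -487963988⟩)
    {N : ℕ} [NeZero N] {K : Type} [Field K] [NumberField K] (hKo : kolyvagin N W K)
    (hB : Kolyvagin1990_padicValNat_card_sha_le N W K) (hK : IsImaginaryQuadratic K)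
    (hH : SatisfiesHeegnerHypothesis N K) {P : (W.baseChange K).toAffine.Point}
    (hP : IsHeegnerPoint N W K P) (hnt : ¬ IsOfFinAddOrder P)
    (hI : padicValNat 3 (AddSubgroup.zmultiples P).index ≤ 1)
    (hr : W.analyticRank = 1) {s : ℚ} (hs : shaAn W = (s : ℂ)) (hv : padicValRat 3 s = 2)
    (W' : WeierstrassCurve ℚ) (hW' : W' = ⟨0, -1, 0, -1233, 18837⟩)
    (θ : geomTorsion W' (3 : ℤ) ≃+ geomTorsion W (3 : ℤ))
    (hθ : ∀ (σ : Field.absoluteGaloisGroup ℚ) (Q : geomTorsion W' (3 : ℤ)), θ (σ • Q) = σ • θ Q) :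
    BSDp W 3 := by
  haveI : Fact (Nat.Prime 3) := ⟨by norm_num⟩
  subst hW hW'
  haveI := isElliptic_c443400c1
  haveI := SecondDescent.isGloballyMinimal_s443400c1
  haveI := isElliptic_c443400b1
  haveI := isGloballyMinimal_c443400b1
  obtain ⟨-, hfin⟩ := hGZK (⟨0, -1, 0, -1172008, -487963988⟩ : WeierstrassCurve ℚ) (by omega)
  have hρ : (⟨0, -1, 0, -1172008, -487963988⟩ : WeierstrassCurve ℚ).HasSurjectiveModNGaloisRep 3 :=
    SecondDescent.surj3_s443400c1
  -- LOWER half: k1-c3's two-witness kernel record, by name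
  have hlow : MissingLowerBoundAt (⟨0, -1, 0, -1172008, -487963988⟩ : WeierstrassCurve ℚ) 3 :=
    missingLowerBoundAt_c443400c1_3_of_congr hCT hGZK rfl rfl hr hs hv.le θ hθ
  -- UPPER half: Kolyvagin at the displayed Heegner datum
  have hup : MissingUpperBoundAt (⟨0, -1, 0, -1172008, -487963988⟩ : WeierstrassCurve ℚ) 3 :=
    X11b.missingUpperBoundAt_of_padicValNat_shaOrder_le _ 3 (k := 1)
      (X11b.padicValNat_shaOrder_le_of_kolyvagin _ 3 hKo hB hK hH hP hnt (by norm_num) hρ hfin hI) hs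
      (by rw [hv]; norm_num)
  exact bsdp_of_missingPPartAt _ 3 hGZK (by omega) (missingPPartAt_of_lower_of_upper _ 3 hlow hup)

/-- **`bsdp_w443400c1` with θ/hθ DISCHARGED IN THE KERNEL** (HESSE GRADE, the n1011 ROW T-VIS3-TH twin pattern of VIS30's
`bsdpHesse_v<label>`): the partner `443400b1` is `ℚ`-isomorphic to the member `(l : m) = (-7660 : 1)` (`u = 2160`) of the DIRECT (`X_E(3)`)
Hesse pencil of `E` (Fisher 2012 Thm. 13.2, `n = 3`; unconditional: `threeCongruent_of_hesseCertificate_unconditional`; certificate found by n1011's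
`tvis3_hesse3_search.py` (f7173afc…) run by this unit, complete rational-root search of the degree-12 `j`-equation), so
`θ : W'[3] ≃ E[3]` comes from ONE call of `VisCerts.torsionIso3_of_hesseCert_mk` with ten `norm_num` identities. Remaining binders:
hCT hGZK W hW hKo hB hK hH hP hnt hI hr hs hv ⊢ `BSDp W 3` — NO θ, NO partner datum, NO local-torsion binder. Per pair; nothing booked.
[cite: Fisher2012Hessian, Thm. 13.2 (n = 3)] [cite: CremonaAlgorithms1997, §3.5] -/
theorem bsdpHesse_w443400c1 (hCT : exists_casselsTate_pairing (K := ℚ))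
    (hGZK : rank_eq_analyticRank_of_analyticRank_le_one)
    (W : WeierstrassCurve ℚ) (hW : W = ⟨0, -1, 0, -1172008, -487963988⟩)
    {N : ℕ} [NeZero N] {K : Type} [Field K] [NumberField K] (hKo : kolyvagin N W K)
    (hB : Kolyvagin1990_padicValNat_card_sha_le N W K) (hK : IsImaginaryQuadratic K)
    (hH : SatisfiesHeegnerHypothesis N K) {P : (W.baseChange K).toAffine.Point}
    (hP : IsHeegnerPoint N W K P) (hnt : ¬ IsOfFinAddOrder P)
    (hI : padicValNat 3 (AddSubgroup.zmultiples P).index ≤ 1)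
    (hr : W.analyticRank = 1) {s : ℚ} (hs : shaAn W = (s : ℂ)) (hv : padicValRat 3 s = 2) :
    BSDp W 3 := by
  haveI : (⟨0, -1, 0, -1233, 18837⟩ : WeierstrassCurve ℚ).IsElliptic := isElliptic_c443400b1
  have hWlit : W = ⟨0, -1, 0, -1172008, -487963988⟩ := hW
  haveI : W.IsElliptic := by rw [hWlit]; exact isElliptic_c443400c1
  obtain ⟨θ, hθ⟩ := VisCerts.torsionIso3_of_hesseCert_mk
    (W' := (⟨0, -1, 0, -1233, 18837⟩ : WeierstrassCurve ℚ)) hWlit rfl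
    56256400 421938424000 59200 (-15920000) (by norm_num) (by norm_num) (by norm_num) (by norm_num)
    (-7660) 1 2160 (by norm_num) (by norm_num) (by norm_num)
  exact bsdp_w443400c1 hCT hGZK W hW hKo hB hK hH hP hnt hI hr hs hv _ rfl θ hθ

/-! ### `352944s1 @ 3` (class X4) — partner `117648bh1` (rank 3) -/

/-- `#Ẽ(𝔽₅) = 7` for Cremona's model `352944s1` (kernel point count on the integral model). [folklore] -/
theorem card_w352944s1_5 :
    Nat.card (((⟨0, 0, 0, -7203, -235294⟩ : WeierstrassCurve ℤ).map
      (Int.castRingHom (ZMod 5))).toAffine.Point) = 7 := by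
  haveI : Fact (Nat.Prime 5) := ⟨by norm_num⟩
  have h := natCard_point_eq_countPoints 0 0 0 (-7203) (-235294) 5 (by norm_num) (by decide +kernel)
  have h' : countPoints [0, 0, 0, -7203, -235294] 5 = 7 := by decide +kernel
  exact_mod_cast h.trans h'

/-- `#Ẽ(𝔽₇) = 3` for Cremona's model `352944s1` (kernel point count on the integral model). [folklore] -/
theorem card_w352944s1_7 :
    Nat.card (((⟨0, 0, 0, -7203, -235294⟩ : WeierstrassCurve ℤ).map
      (Int.castRingHom (ZMod 7))).toAffine.Point) = 3 := by
  haveI : Fact (Nat.Prime 7) := ⟨by norm_num⟩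
  have h := natCard_point_eq_countPoints 0 0 0 (-7203) (-235294) 7 (by norm_num) (by decide +kernel)
  have h' : countPoints [0, 0, 0, -7203, -235294] 7 = 3 := by decide +kernel
  exact_mod_cast h.trans h'

/-- **`ρ̄_{E,3}` is onto for `352944s1`**, in the kernel (`GaloisImage/FrobeniusOrderWitness`): `ℓ₁ = 5` (`#Ẽ(𝔽₅) = 7`,
`a = -1`: `X² − aX + 5` has no root mod `3`) and `ℓ₂ = 7` (`7 ≡ 1 (mod 3)`, `#Ẽ(𝔽₇) = 3`, `a = 5 ≡ 2 (mod 3)`, `9 ∤ 3`: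
a Frobenius of ORDER `3` on `E[3]`), for any globally minimal elliptic `W/ℚ` with this integral model. Readings outside the kernel agree
(Cremona/Sutherland `galrep`: no `3`-adic image label; hyp ENGINE V surj(3) G/A/B = 1/1/1). [cite: Serre1972, §2.4 Prop. 15] -/
theorem surj3_w352944s1 {W : WeierstrassCurve ℚ} [W.IsElliptic] [W.IsGloballyMinimal]
    (hI : integralModelInt W = ⟨0, 0, 0, -7203, -235294⟩) : W.HasSurjectiveModNGaloisRep 3 :=
  @hasSurjectiveModNGaloisRep_of_intModel_of_irr_of_order W _ _ _ hI 3 ⟨by norm_num⟩ 5 7 ⟨by norm_num⟩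
    ⟨by norm_num⟩ (by norm_num) (by norm_num) (by decide +kernel) (by decide +kernel) _ _
    card_w352944s1_5 card_w352944s1_7 (by decide) (by decide) (by decide) (by decide)

/-- **`BSD(E,3)` for `352944s1`** (class X4; `N = 352944 = 2⁴·3³·19·43`; at `3`: additive `IV` (`v₃(N) = 3`, `c₃ = 1`), additive `I₄*` at `2` (`c₂ = 2`), `I₁` at `19`, `43`; `ρ̄_{E,3}` onto; `r_an = 1`; `#E(ℚ)_tors = 1`;
`∏ c_q = 2`; `#Ш_an = 9`; other members of the isogeny class by `bsdp_iff_of_isIsogenous`) from PUBLISHED theorems — Kolyvagin's index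
bound (`hKo`, `hB`: McCallum 1991 §1 / Gross 1991 Thm. 1.3), Cassels–Tate (`hCT`), Gross–Zagier–Kolyvagin (`hGZK`) — plus the
per-pair certificates: UPPER half = a Heegner datum with `ord₃ [E(K):ℤP] ≤ 1` — the lane's two fields `D = -287` (`m = 36`) and `D = -335` (`m = 72`) read `ord₃ m = 2`
(`3 ∤ ∏c_q = 2`), so this unit scanned DEEPER fields (engine 1 = gen 3 engine VERBATIM, kit j276927, 24 Heegner discriminants `|D| ≤ 2711`):
`K = ℚ(√-383)`, `m = 84`, `ord₃ m = 1` (also `D = -407, -743, -839, -863, …` with `ord₃ m = 1`; engine 2 = kit j277072), DISPLAYED as hK hH hP hnt hI; LOWER half =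
k1-c3 g7's two-witness KERNEL record `missingLowerBoundAt_c352944s1_3_of_congr` (`Visibility/TwoWitnessLowerHalf352944s1.lean`: partner
`W' = 117648bh1` of rank `3`, witnesses `T₁, T₂ ∈ W'(ℚ)` independent mod `3W'(ℚ)` and locally `3`-divisible / harmless on `S = {2, 3, 19, 43}`,
`E[3]` irreducible, minimality, good reduction off `S` — all in the kernel) BY NAME, with the `3`-CONGRUENCE `θ : W'[3] ≃ E[3]` DISPLAYED
(certified outside the kernel: Kraus–Oesterlé `a_ℓ(E) ≡ a_ℓ(W') (mod 3)` for every `ℓ ≤ B = 126719` (`M = 352944`), TWO engines to the FULL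
bound, hyp ENGINE V-A (python) / V-B (PARI 2.17.2), jobs j082351–j083043, `vis_triples.tsv.gz` row (352944s1, 3, 117648bh1): `H_cong = 1` agree, `cong_full_two_engine = True`); `ρ̄_{E,3}` onto by `surj3_w352944s1` (this file). Composition = `X11b.padicValNat_shaOrder_le_of_kolyvagin` +
`X11b.missingUpperBoundAt_of_padicValNat_shaOrder_le` + `bsdp_of_missingPPartAt`. Per pair; the lane / referee A book the verdict;
no label change; nothing booked here. [cite: McCallumLMS1991, §1 Theorem (Kolyvagin), p. 296] [cite: GrossLMS1991, Thm. 1.3]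
[cite: CremonaMazur2000, §3 and Table 1] [cite: AgasheStein2002, Lemma 3.6] [cite: KrausOesterle1992, Prop. 4]
[cite: Miller2011LMS, §1 and Def. 1.1] [cite: Cremona2006, Table 1 (352944s1, 117648bh1)] -/
theorem bsdp_w352944s1 (hCT : exists_casselsTate_pairing (K := ℚ))
    (hGZK : rank_eq_analyticRank_of_analyticRank_le_one)
    (W : WeierstrassCurve ℚ) (hW : W = ⟨0, 0, 0, -7203, -235294⟩)
    {N : ℕ} [NeZero N] {K : Type} [Field K] [NumberField K] (hKo : kolyvagin N W K)
    (hB : Kolyvagin1990_padicValNat_card_sha_le N W K) (hK : IsImaginaryQuadratic K)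
    (hH : SatisfiesHeegnerHypothesis N K) {P : (W.baseChange K).toAffine.Point}
    (hP : IsHeegnerPoint N W K P) (hnt : ¬ IsOfFinAddOrder P)
    (hI : padicValNat 3 (AddSubgroup.zmultiples P).index ≤ 1)
    (hr : W.analyticRank = 1) {s : ℚ} (hs : shaAn W = (s : ℂ)) (hv : padicValRat 3 s = 2)
    (W' : WeierstrassCurve ℚ) (hW' : W' = ⟨0, 0, 0, -2307, 42050⟩)
    (θ : geomTorsion W' (3 : ℤ) ≃+ geomTorsion W (3 : ℤ))
    (hθ : ∀ (σ : Field.absoluteGaloisGroup ℚ) (Q : geomTorsion W' (3 : ℤ)), θ (σ • Q) = σ • θ Q) :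
    BSDp W 3 := by
  haveI : Fact (Nat.Prime 3) := ⟨by norm_num⟩
  subst hW hW'
  haveI := isElliptic_c352944s1
  haveI := isGloballyMinimal_c352944s1
  haveI := isElliptic_c117648bh1
  haveI := isGloballyMinimal_c117648bh1
  obtain ⟨-, hfin⟩ := hGZK (⟨0, 0, 0, -7203, -235294⟩ : WeierstrassCurve ℚ) (by omega)
  have hρ : (⟨0, 0, 0, -7203, -235294⟩ : WeierstrassCurve ℚ).HasSurjectiveModNGaloisRep 3 :=
    surj3_w352944s1 (integralModelInt_eq_of_map_eq _ (map_mk_int 0 0 0 (-7203) (-235294)))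
  -- LOWER half: k1-c3's two-witness kernel record, by name
  have hlow : MissingLowerBoundAt (⟨0, 0, 0, -7203, -235294⟩ : WeierstrassCurve ℚ) 3 :=
    missingLowerBoundAt_c352944s1_3_of_congr hCT hGZK rfl rfl hr hs hv.le θ hθ
  -- UPPER half: Kolyvagin at the displayed Heegner datum
  have hup : MissingUpperBoundAt (⟨0, 0, 0, -7203, -235294⟩ : WeierstrassCurve ℚ) 3 :=
    X11b.missingUpperBoundAt_of_padicValNat_shaOrder_le _ 3 (k := 1)
      (X11b.padicValNat_shaOrder_le_of_kolyvagin _ 3 hKo hB hK hH hP hnt (by norm_num) hρ hfin hI) hs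
      (by rw [hv]; norm_num)
  exact bsdp_of_missingPPartAt _ 3 hGZK (by omega) (missingPPartAt_of_lower_of_upper _ 3 hlow hup)

/-- **`bsdp_w352944s1` with θ/hθ DISCHARGED IN THE KERNEL** (HESSE GRADE, the n1011 ROW T-VIS3-TH twin pattern of VIS30's
`bsdpHesse_v<label>`): the partner `117648bh1` is `ℚ`-isomorphic to the member `(l : m) = (-612 : 1)` (`u = 48`) of the DIRECT (`X_E(3)`)
Hesse pencil of `E` (Fisher 2012 Thm. 13.2, `n = 3`; unconditional: `threeCongruent_of_hesseCertificate_unconditional`; certificate found by n1011's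
`tvis3_hesse3_search.py` (f7173afc…) run by this unit, complete rational-root search of the degree-12 `j`-equation), so
`θ : W'[3] ≃ E[3]` comes from ONE call of `VisCerts.torsionIso3_of_hesseCert_mk` with ten `norm_num` identities. Remaining binders:
hCT hGZK W hW hKo hB hK hH hP hnt hI hr hs hv ⊢ `BSDp W 3` — NO θ, NO partner datum, NO local-torsion binder. Per pair; nothing booked.
[cite: Fisher2012Hessian, Thm. 13.2 (n = 3)] [cite: CremonaAlgorithms1997, §3.5] -/
theorem bsdpHesse_w352944s1 (hCT : exists_casselsTate_pairing (K := ℚ))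
    (hGZK : rank_eq_analyticRank_of_analyticRank_le_one)
    (W : WeierstrassCurve ℚ) (hW : W = ⟨0, 0, 0, -7203, -235294⟩)
    {N : ℕ} [NeZero N] {K : Type} [Field K] [NumberField K] (hKo : kolyvagin N W K)
    (hB : Kolyvagin1990_padicValNat_card_sha_le N W K) (hK : IsImaginaryQuadratic K)
    (hH : SatisfiesHeegnerHypothesis N K) {P : (W.baseChange K).toAffine.Point}
    (hP : IsHeegnerPoint N W K P) (hnt : ¬ IsOfFinAddOrder P)
    (hI : padicValNat 3 (AddSubgroup.zmultiples P).index ≤ 1)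
    (hr : W.analyticRank = 1) {s : ℚ} (hs : shaAn W = (s : ℂ)) (hv : padicValRat 3 s = 2) :
    BSDp W 3 := by
  haveI : (⟨0, 0, 0, -2307, 42050⟩ : WeierstrassCurve ℚ).IsElliptic := isElliptic_c117648bh1
  have hWlit : W = ⟨0, 0, 0, -7203, -235294⟩ := hW
  haveI : W.IsElliptic := by rw [hWlit]; exact isElliptic_c352944s1
  obtain ⟨θ, hθ⟩ := VisCerts.torsionIso3_of_hesseCert_mk
    (W' := (⟨0, 0, 0, -2307, 42050⟩ : WeierstrassCurve ℚ)) hWlit rfl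
    345744 203294016 110736 (-36331200) (by norm_num) (by norm_num) (by norm_num) (by norm_num)
    (-612) 1 48 (by norm_num) (by norm_num) (by norm_num)
  exact bsdp_w352944s1 hCT hGZK W hW hKo hB hK hH hP hnt hI hr hs hv _ rfl θ hθ

end Summit.BirchSwinnertonDyer.Rank1Residual.Visibility

end
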